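import Literature.Geometry.Kaehler.ComplexTorusFourierMinimalClasses
import HarnessLib

/-!
# The index of the top splitting against the least complementary `θ`-degree: `[Hdgᵖ(X, ℤ) : ℤγ_p ⊕ γ_p^⊥]·δ_{g−p} = g!/(g−p)!` on a principally
# polarised torus, and `[Hdgᵖ(X, ℤ) : ℤγ_p ⊕ γ_p^⊥]·δ̂_{g−p}(X̂, E_δ)·C_p·C_{g−p} = C_g·Ĉ_p` for every type

Layer `Literature/Geometry/Kaehler`, namespace `Literature.Geometry.Kaehler.ComplexTorus`; lane `lit-hodgefound`
(Track 2 foundations library), seat p09, generation 50, row g50-#3. THEOREMS ONLY (0 definitions); no named fact, net debt 0.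
Sequel of g48-#6 `ComplexTorusIntegralHodgeLatticeTopMinimalClassValueGroup` (THE SHARP INDEX FORMULA `J_p·n_p·C_p·C_{g−p} = C_g` for the index
`J_p = [Hdgᵖ(X, ℤ) : ℤγ_p ⊕ γ_p^⊥]` of the top splitting of the integral Hodge lattice by its minimal class `γ_p = θ^{∧p}/C_p`, `C_m = m!·d₁⋯d_m`,
`2p + q = g`, `B = ⟨·, γ_q ∧ ·⟩_e`, and the index `n_p = [B(γ_p, H^{2p}(X, ℤ)) : B(γ_p, Hdgᵖ(X, ℤ))]`), of g49-#7 (`n_p` generates the value group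
`⟨γ_{g−p}, Hdgᵖ(X, ℤ)⟩`), of g49-#11 `ComplexTorusIntegralHodgeLatticeThetaDegrees` (the `θ`-degree generators `δ_k`), of g50-#1
`ComplexTorusIntegralHodgeLatticeThetaDegreesFourierDuality` (principal: `δ_k·k! = δ_{g−k}·(g−k)!`) and of g50-#2 `ComplexTorusFourierMinimalClasses`
(`⟨γ_k, Hdg^l(X, ℤ)⟩ = ⟨γ̂_l, Hdgᵏ(X̂, ℤ)⟩` under the Fourier transform).

THE POINT. The factor `n_p` of the sharp index formula is a LOWER-half invariant (`2p ≤ g`, the value group of `γ_{g−p}` on `Hdgᵖ`). The Fourier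
duality identifies it with an invariant of the COMPLEMENTARY codimension `g − p`: the least `θ`-degree `δ_{g−p} = min{⟨θ^{∧p}, w⟩ > 0 : w ∈ Hdg^{g−p}(X, ℤ)}`
(on `X` itself for a principal polarisation, on the dual polarised torus `(X̂, E_δ)` in general):

* §1 PRINCIPAL POLARISATION (`IsPolarizationType.index_top_splitting_mul_thetaDegree_generator_eq_of_type_one`):
  **`[Hdgᵖ(X, ℤ) : ℤγ_p ⊕ γ_p^⊥] · δ_{g−p} = (g choose p)·p! = g!/(g−p)!`** (`J_p·n_p = (g choose p)`, `δ_p = (g−p)!·n_p`, and `δ_p·p! = δ_{g−p}·(g−p)!`, so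
  `δ_{g−p} = p!·n_p`). For `p = 1`: **`[NS(X) : ℤθ ⊕ NS(X)_prim] · (least θ-degree of an integral Hodge curve class) = g`**; in particular
  `J_p = 1 ⟺ δ_{g−p} = g!/(g−p)!` and `J_p = g!/(g−p)! ⟺ δ_{g−p} = 1` (`IsPolarizationType.index_top_splitting_eq_one_iff_thetaDegree_generator_eq_of_type_one`,
  `…_eq_iff_thetaDegree_generator_eq_one_of_type_one`): the top splitting of `NS(X)` is everything iff every integral Hodge curve class has
  `θ`-degree divisible by `g`, and has the maximal index `g` iff some integral Hodge curve class has `θ`-degree `1`.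
* §2 EVERY TYPE (`IsPolarizationType.index_top_splitting_mul_dual_thetaDegree_generator_mul_content_eq`):
  **`J_p(X) · δ̂_{g−p}(X̂, E_δ) · C_p · C_{g−p} = C_g · Ĉ_p`**, where `δ̂_{g−p}(X̂, E_δ)` is the least positive `θ̂^{∧p}`-degree of a class in
  `Hdg^{g−p}(X̂, ℤ)` for the dual polarisation `θ̂ = E_δ = d₁d_g·E^*` and `Ĉ_p = p!·δ̂₁⋯δ̂_p` its content (`n_p` generates `⟨γ_{g−p}, Hdgᵖ(X, ℤ)⟩ =
  ⟨γ̂_p, Hdg^{g−p}(X̂, ℤ)⟩`, so `δ̂_{g−p}(X̂) = Ĉ_p·n_p`).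

## Contents (theorems only; no definition, no named fact)

* §1 **`IsPolarizationType.index_top_splitting_mul_thetaDegree_generator_eq_of_type_one`**,
  `IsPolarizationType.index_top_splitting_eq_one_iff_thetaDegree_generator_eq_of_type_one`,
  `IsPolarizationType.index_top_splitting_eq_iff_thetaDegree_generator_eq_one_of_type_one`,
  `IsPolarizationType.exists_index_top_splitting_mul_thetaDegree_generator_eq_of_type_one` (data-free form),
  `IsPolarizationType.index_top_splitting_mul_thetaDegree_generator_eq_two_of_surface` (`g = 2`: `[NS(X) : ℤθ ⊕ θ^⊥]·min{(θ·D) > 0} = 2`).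
* §2 `IsPolarizationType.dual_thetaDegree_generator_eq_content_mul_relIndex`,
  **`IsPolarizationType.index_top_splitting_mul_dual_thetaDegree_generator_mul_content_eq`**.

## References

* [cite: Lange2023AbelianVarietiesComplex, §5.4.1 Thm. 5.4.2 and (5.22)–(5.23) (PDF p. 275); §2.5.3 Thm. 2.5.16, Cor. 2.5.17 (d) (PDF p. 135); §6.2.4 Prop. 6.2.20, Prop. 6.2.21 (pp. 310–311); §6.3.2 Thm. 6.3.5 (p. 315); §2.5.1 Prop. 2.5.1 (p. 131); §2.4.3 Prop. 2.4.12 (b)]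
* [cite: Beauville1983FourierChow, §3 Prop. 5 (p. 248)]
* [cite: BenoistDebarre2023SmoothSubvarietiesJacobians, §1 (p. 3); §3 Prop. 3.3 and proof of Thm. 3.7 (p. 7)]
* [cite: Huybrechts2016K3, Ch. 14 §0.1–§0.2 (PDF p. 333)]
-/

noncomputable section

-- `Module ℂ` / `SMulZeroClass ℂ` synthesis on `E [⋀^Fin k]→L[ℝ] ℂ` (as in `ComplexTorusLefschetzDecomposition`)
set_option maxSynthPendingDepth 3

open Module Function Complex
open LinearMap (BilinForm)
open Literature.LinearAlgebra.Alternating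

namespace Literature.Geometry.Kaehler.ComplexTorus

universe uE

/-! ## §1 Principal polarisation: `[Hdgᵖ(X, ℤ) : ℤγ_p ⊕ γ_p^⊥]·δ_{g−p} = g!/(g−p)!` -/

section Principal

variable {ι : Type*} [Fintype ι] [LinearOrder ι] {E : Type uE} [NormedAddCommGroup E] [NormedSpace ℂ E]
  (Φ : (ι → ℝ) ≃L[ℝ] E) {j n p q : ℕ} {η : E [⋀^Fin 2]→L[ℝ] ℝ} {d : Fin (j + 2) → ℕ}

/-- `a = b·c` and `a·p = δ'·b` with `b > 0` give `δ' = c·p` (naturals). [folklore] -/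
private theorem eq_mul_of_mul_eq₁₀₅ {a b c p δ' : ℕ} (h₁ : a = b * c) (h₂ : a * p = δ' * b) (hb : 0 < b) : δ' = c * p := by
  apply Nat.eq_of_mul_eq_mul_left hb
  calc b * δ' = δ' * b := mul_comm _ _
    _ = a * p := h₂.symm
    _ = b * (c * p) := by rw [h₁, mul_assoc]

/-- **PRINCIPAL POLARISATION: `[Hdgᵖ(X, ℤ) : ℤγ_p ⊕ γ_p^⊥] · δ_{g−p} = (g choose p)·p!` and `· (g−p)! = g!`** (`2p + q = g`, `γ_p = θ^{∧p}/p!`, `γ_p^⊥` for the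
integral Lefschetz form `B = ⟨·, γ_q ∧ ·⟩_e` on the Hodge lattice `M = Hdgᵖ(X, ℤ)`, `Λ = ℤγ_p`; `δ_{g−p}` the least positive `θ`-degree `⟨θ^{∧p}, w⟩_e` of a class
`w ∈ Hdg^{g−p}(X, ℤ)`, characterised as a generator): g48-#6's `J_p·n_p = (g choose p)`, g49-#11's `δ_p = (g−p)!·n_p` and g50-#1's Fourier
symmetry `δ_p·p! = δ_{g−p}·(g−p)!` give `δ_{g−p} = p!·n_p`. For `p = 1` (`q = g − 2`):
**`[NS(X) : ℤθ ⊕ NS(X)_prim] · (least θ-degree of an integral Hodge curve class) = g`.**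
[cite: Lange2023AbelianVarietiesComplex, §5.4.1 (5.22)–(5.23) (PDF p. 275); §2.5.3 Cor. 2.5.17 (d) (PDF p. 135); §6.2.4 Prop. 6.2.20 (pp. 310–311); §6.3.2 Thm. 6.3.5 (p. 315); §2.4.3 Prop. 2.4.12 (b)] [cite: Beauville1983FourierChow, §3 Prop. 5 (p. 248)] [cite: BenoistDebarre2023SmoothSubvarietiesJacobians, §1 (p. 3); §3 Prop. 3.3] -/
theorem IsPolarizationType.index_top_splitting_mul_thetaDegree_generator_eq_of_type_one (hd : IsPolarizationType Φ η d)
    (hη : IsRiemannForm Φ η) (h1 : ∀ i, d i = 1) (hp : p ≤ j + 2) (hq : q ≤ j + 2) (hpq : p + q ≤ j + 2) (hkq : 2 * p + q = j + 2)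
    {γq : E [⋀^Fin (2 * q)]→L[ℝ] ℂ} (hγq : wedgePow (ofRealForm η) q = ((q.factorial * ∏ i : Fin q, d (Fin.castLE hq i) : ℕ) : ℂ) • γq)
    (e : Fin n ≃ ι) (hn : 2 * p + (2 * q + 2 * p) = n) (hn₁ : 2 * (p + q) + 2 * p = n) (hn₂ : 2 * p + 2 * (p + q) = n)
    {B : BilinForm ℤ ↥(integralForms Φ (2 * p))}
    (hB : ∀ x y : ↥(integralForms Φ (2 * p)),
      ((B x y : ℤ) : ℂ) = poincarePairing Φ e hn (x : E [⋀^Fin (2 * p)]→L[ℝ] ℂ) (γq.wedge (y : E [⋀^Fin (2 * p)]→L[ℝ] ℂ)))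
    (γM : ↥(AddSubgroup.toIntSubmodule ((integralHodgeClassesIn Φ (2 * p) p).addSubgroupOf (integralForms Φ (2 * p)))))
    (hγM : wedgePow (ofRealForm η) p = ((p.factorial * ∏ i : Fin p, d (Fin.castLE hp i) : ℕ) : ℂ) •
      (((γM : ↥(AddSubgroup.toIntSubmodule ((integralHodgeClassesIn Φ (2 * p) p).addSubgroupOf (integralForms Φ (2 * p))))) :
        ↥(integralForms Φ (2 * p))) : E [⋀^Fin (2 * p)]→L[ℝ] ℂ))
    (Λ : Submodule ℤ ↥(AddSubgroup.toIntSubmodule ((integralHodgeClassesIn Φ (2 * p) p).addSubgroupOf (integralForms Φ (2 * p)))))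
    (hΛ : ∀ x, x ∈ Λ ↔ ∃ a : ℤ, a • γM = x) {δ' : ℕ}
    (hδ' : (∀ w ∈ integralHodgeClassesIn Φ (2 * (p + q)) (p + q), ∃ c : ℤ,
        poincarePairing Φ e hn₂ (wedgePow (ofRealForm η) p) w = c ∧ (δ' : ℤ) ∣ c) ∧
      ∃ w ∈ integralHodgeClassesIn Φ (2 * (p + q)) (p + q), poincarePairing Φ e hn₂ (wedgePow (ofRealForm η) p) w = (δ' : ℂ)) :
    (Λ ⊔ (B.restrict (AddSubgroup.toIntSubmodule ((integralHodgeClassesIn Φ (2 * p) p).addSubgroupOf (integralForms Φ (2 * p))))).orthogonal Λ).toAddSubgroup.index *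
          δ' = (j + 2).choose p * p.factorial ∧
      (Λ ⊔ (B.restrict (AddSubgroup.toIntSubmodule ((integralHodgeClassesIn Φ (2 * p) p).addSubgroupOf (integralForms Φ (2 * p))))).orthogonal Λ).toAddSubgroup.index *
          δ' * (p + q).factorial = (j + 2).factorial := by
  obtain ⟨γpq, -, hγpq⟩ := hd.exists_mem_integralForms_wedgePow_eq_content_smul hpq
  -- the `θ^{∧(p+q)}`-degree generator `δ_p` of `Hdgᵖ(X, ℤ)`
  obtain ⟨δ, -, hδ⟩ := hd.exists_thetaDegree_generator hη hp (show p + (p + q) = j + 2 by omega) e hn₁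
  have hJ := hd.index_top_splitting_mul_relIndex_range_eq_choose hη h1 hp hq hpq hkq hγq e hn hB γM hγM Λ hΛ
  have hδeq := hd.thetaDegree_generator_eq_content_mul_relIndex hη hp hq hpq hγq hγpq e hn hn₁ hB γM hγM hδ
  have hsym := hd.thetaDegree_generator_mul_factorial_eq_of_type_one Φ hη h1 (show p + (p + q) = j + 2 by omega) e hn₁ hn₂ hδ hδ'
  -- principal: the content of `θ^{∧(p+q)}` is `(p+q)!`
  simp only [h1, Finset.prod_const_one, mul_one] at hδeq
  have hδ'eq := eq_mul_of_mul_eq₁₀₅ hδeq hsym (Nat.factorial_pos _)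
  have hch := Nat.choose_mul_factorial_mul_factorial hp
  rw [show j + 2 - p = p + q by omega] at hch
  refine ⟨?_, ?_⟩
  · rw [hδ'eq, ← mul_assoc, hJ]
  · rw [hδ'eq, ← mul_assoc, hJ, hch]

/-- `J·δ = N` with `N > 0`: `J = 1 ⟺ δ = N` and `J = N ⟺ δ = 1`. [folklore] -/
private theorem eq_one_iff_and_eq_iff₁₀₅ {J δ N : ℕ} (h : J * δ = N) (hN : 0 < N) : (J = 1 ↔ δ = N) ∧ (J = N ↔ δ = 1) := by
  have hJ : 0 < J := Nat.pos_of_ne_zero fun h0 ↦ by rw [h0, zero_mul] at h; omega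
  have hδ : 0 < δ := Nat.pos_of_ne_zero fun h0 ↦ by rw [h0, mul_zero] at h; omega
  refine ⟨⟨fun h1 ↦ by rw [h1, one_mul] at h; exact h, fun h1 ↦ ?_⟩, ⟨fun h1 ↦ ?_, fun h1 ↦ by rw [h1, mul_one] at h; exact h⟩⟩
  · rw [h1] at h
    exact Nat.eq_of_mul_eq_mul_right hN (h.trans (one_mul _).symm)
  · rw [h1] at h
    exact Nat.eq_of_mul_eq_mul_left hN (h.trans (mul_one _).symm)

/-- **`J_p = 1 ⟺ δ_{g−p} = (g choose p)·p!` on a principally polarised torus**: the top splitting is all of `Hdgᵖ(X, ℤ)` (`Hdgᵖ(X, ℤ) = ℤγ_p ⊕ γ_p^⊥`) iff every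
integral Hodge class of codimension `g − p` has `θ^{∧p}`-degree divisible by `g!/(g−p)!` (for `p = 1`: `NS(X) = ℤθ ⊕ NS(X)_prim` iff every integral Hodge
curve class has `θ`-degree divisible by `g` — e.g. the very general p.p.a.v., g49-#12).
[cite: Lange2023AbelianVarietiesComplex, §5.4.1 (5.22)–(5.23) (PDF p. 275); §6.3.2 Thm. 6.3.5 (p. 315); §7.3.1 Thm. 7.3.1] [cite: BenoistDebarre2023SmoothSubvarietiesJacobians, §1 (p. 3); §3 Prop. 3.3] -/
theorem IsPolarizationType.index_top_splitting_eq_one_iff_thetaDegree_generator_eq_of_type_one (hd : IsPolarizationType Φ η d)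
    (hη : IsRiemannForm Φ η) (h1 : ∀ i, d i = 1) (hp : p ≤ j + 2) (hq : q ≤ j + 2) (hpq : p + q ≤ j + 2) (hkq : 2 * p + q = j + 2)
    {γq : E [⋀^Fin (2 * q)]→L[ℝ] ℂ} (hγq : wedgePow (ofRealForm η) q = ((q.factorial * ∏ i : Fin q, d (Fin.castLE hq i) : ℕ) : ℂ) • γq)
    (e : Fin n ≃ ι) (hn : 2 * p + (2 * q + 2 * p) = n) (hn₁ : 2 * (p + q) + 2 * p = n) (hn₂ : 2 * p + 2 * (p + q) = n)
    {B : BilinForm ℤ ↥(integralForms Φ (2 * p))}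
    (hB : ∀ x y : ↥(integralForms Φ (2 * p)),
      ((B x y : ℤ) : ℂ) = poincarePairing Φ e hn (x : E [⋀^Fin (2 * p)]→L[ℝ] ℂ) (γq.wedge (y : E [⋀^Fin (2 * p)]→L[ℝ] ℂ)))
    (γM : ↥(AddSubgroup.toIntSubmodule ((integralHodgeClassesIn Φ (2 * p) p).addSubgroupOf (integralForms Φ (2 * p)))))
    (hγM : wedgePow (ofRealForm η) p = ((p.factorial * ∏ i : Fin p, d (Fin.castLE hp i) : ℕ) : ℂ) •
      (((γM : ↥(AddSubgroup.toIntSubmodule ((integralHodgeClassesIn Φ (2 * p) p).addSubgroupOf (integralForms Φ (2 * p))))) :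
        ↥(integralForms Φ (2 * p))) : E [⋀^Fin (2 * p)]→L[ℝ] ℂ))
    (Λ : Submodule ℤ ↥(AddSubgroup.toIntSubmodule ((integralHodgeClassesIn Φ (2 * p) p).addSubgroupOf (integralForms Φ (2 * p)))))
    (hΛ : ∀ x, x ∈ Λ ↔ ∃ a : ℤ, a • γM = x) {δ' : ℕ}
    (hδ' : (∀ w ∈ integralHodgeClassesIn Φ (2 * (p + q)) (p + q), ∃ c : ℤ,
        poincarePairing Φ e hn₂ (wedgePow (ofRealForm η) p) w = c ∧ (δ' : ℤ) ∣ c) ∧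
      ∃ w ∈ integralHodgeClassesIn Φ (2 * (p + q)) (p + q), poincarePairing Φ e hn₂ (wedgePow (ofRealForm η) p) w = (δ' : ℂ)) :
    (Λ ⊔ (B.restrict (AddSubgroup.toIntSubmodule ((integralHodgeClassesIn Φ (2 * p) p).addSubgroupOf (integralForms Φ (2 * p))))).orthogonal Λ).toAddSubgroup.index = 1 ↔
      δ' = (j + 2).choose p * p.factorial :=
  (eq_one_iff_and_eq_iff₁₀₅ (hd.index_top_splitting_mul_thetaDegree_generator_eq_of_type_one Φ hη h1 hp hq hpq hkq hγq e hn hn₁ hn₂ hB γM hγM Λ hΛ hδ').1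
    (Nat.mul_pos (Nat.choose_pos hp) (Nat.factorial_pos _))).1

/-- **`J_p = (g choose p)·p! ⟺ δ_{g−p} = 1` on a principally polarised torus**: the top splitting has the MAXIMAL index `g!/(g−p)!` iff some integral Hodge
class of codimension `g − p` has `θ^{∧p}`-degree `1` (for `p = 1`: `[NS(X) : ℤθ ⊕ NS(X)_prim] = g` iff some integral Hodge curve class has `θ`-degree `1`).
[cite: Lange2023AbelianVarietiesComplex, §5.4.1 (5.22)–(5.23) (PDF p. 275); §6.3.2 Thm. 6.3.5 (p. 315)] [cite: BenoistDebarre2023SmoothSubvarietiesJacobians, §1 (p. 3); §3 Prop. 3.3] -/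
theorem IsPolarizationType.index_top_splitting_eq_iff_thetaDegree_generator_eq_one_of_type_one (hd : IsPolarizationType Φ η d)
    (hη : IsRiemannForm Φ η) (h1 : ∀ i, d i = 1) (hp : p ≤ j + 2) (hq : q ≤ j + 2) (hpq : p + q ≤ j + 2) (hkq : 2 * p + q = j + 2)
    {γq : E [⋀^Fin (2 * q)]→L[ℝ] ℂ} (hγq : wedgePow (ofRealForm η) q = ((q.factorial * ∏ i : Fin q, d (Fin.castLE hq i) : ℕ) : ℂ) • γq)
    (e : Fin n ≃ ι) (hn : 2 * p + (2 * q + 2 * p) = n) (hn₁ : 2 * (p + q) + 2 * p = n) (hn₂ : 2 * p + 2 * (p + q) = n)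
    {B : BilinForm ℤ ↥(integralForms Φ (2 * p))}
    (hB : ∀ x y : ↥(integralForms Φ (2 * p)),
      ((B x y : ℤ) : ℂ) = poincarePairing Φ e hn (x : E [⋀^Fin (2 * p)]→L[ℝ] ℂ) (γq.wedge (y : E [⋀^Fin (2 * p)]→L[ℝ] ℂ)))
    (γM : ↥(AddSubgroup.toIntSubmodule ((integralHodgeClassesIn Φ (2 * p) p).addSubgroupOf (integralForms Φ (2 * p)))))
    (hγM : wedgePow (ofRealForm η) p = ((p.factorial * ∏ i : Fin p, d (Fin.castLE hp i) : ℕ) : ℂ) •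
      (((γM : ↥(AddSubgroup.toIntSubmodule ((integralHodgeClassesIn Φ (2 * p) p).addSubgroupOf (integralForms Φ (2 * p))))) :
        ↥(integralForms Φ (2 * p))) : E [⋀^Fin (2 * p)]→L[ℝ] ℂ))
    (Λ : Submodule ℤ ↥(AddSubgroup.toIntSubmodule ((integralHodgeClassesIn Φ (2 * p) p).addSubgroupOf (integralForms Φ (2 * p)))))
    (hΛ : ∀ x, x ∈ Λ ↔ ∃ a : ℤ, a • γM = x) {δ' : ℕ}
    (hδ' : (∀ w ∈ integralHodgeClassesIn Φ (2 * (p + q)) (p + q), ∃ c : ℤ,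
        poincarePairing Φ e hn₂ (wedgePow (ofRealForm η) p) w = c ∧ (δ' : ℤ) ∣ c) ∧
      ∃ w ∈ integralHodgeClassesIn Φ (2 * (p + q)) (p + q), poincarePairing Φ e hn₂ (wedgePow (ofRealForm η) p) w = (δ' : ℂ)) :
    (Λ ⊔ (B.restrict (AddSubgroup.toIntSubmodule ((integralHodgeClassesIn Φ (2 * p) p).addSubgroupOf (integralForms Φ (2 * p))))).orthogonal Λ).toAddSubgroup.index =
        (j + 2).choose p * p.factorial ↔ δ' = 1 :=
  (eq_one_iff_and_eq_iff₁₀₅ (hd.index_top_splitting_mul_thetaDegree_generator_eq_of_type_one Φ hη h1 hp hq hpq hkq hγq e hn hn₁ hn₂ hB γM hγM Λ hΛ hδ').1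
    (Nat.mul_pos (Nat.choose_pos hp) (Nat.factorial_pos _))).2

/-- **DATA-FREE FORM (principal polarisation, `2p + q = g`)**: there are the minimal class `γ_p ∈ Hdgᵖ(X, ℤ)` (`θ^{∧p} = p!·γ_p`), a symmetric integral Lefschetz
form `B = ⟨·, γ_q ∧ ·⟩_e` on `H^{2p}(X, ℤ)` and the least positive `θ^{∧p}`-degree `δ_{g−p} > 0` of the classes in `Hdg^{g−p}(X, ℤ)`, such that for the line
`Λ = ℤγ_p ⊆ Hdgᵖ(X, ℤ)`: **`[Hdgᵖ(X, ℤ) : Λ ⊕ Λ^⊥] · δ_{g−p} = (g choose p)·p!`**.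
[cite: Lange2023AbelianVarietiesComplex, §5.4.1 Thm. 5.4.2 and (5.22)–(5.23) (PDF p. 275); §2.5.3 Cor. 2.5.17 (d) (PDF p. 135); §6.3.2 Thm. 6.3.5 (p. 315); §6.2.4 (PDF p. 310 L9–L13)] [cite: Beauville1983FourierChow, §3 Prop. 5 (p. 248)] [cite: BenoistDebarre2023SmoothSubvarietiesJacobians, §1 (p. 3)] -/
theorem IsPolarizationType.exists_index_top_splitting_mul_thetaDegree_generator_eq_of_type_one (hd : IsPolarizationType Φ η d)
    (hη : IsRiemannForm Φ η) (h1 : ∀ i, d i = 1) (hp : p ≤ j + 2) (hq : q ≤ j + 2) (hpq : p + q ≤ j + 2) (hkq : 2 * p + q = j + 2)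
    (e : Fin n ≃ ι) (hn : 2 * p + (2 * q + 2 * p) = n) (hn₂ : 2 * p + 2 * (p + q) = n) :
    ∃ (γM : ↥(AddSubgroup.toIntSubmodule ((integralHodgeClassesIn Φ (2 * p) p).addSubgroupOf (integralForms Φ (2 * p)))))
      (γq : E [⋀^Fin (2 * q)]→L[ℝ] ℂ) (B : BilinForm ℤ ↥(integralForms Φ (2 * p))) (δ' : ℕ),
      wedgePow (ofRealForm η) p = ((p.factorial * ∏ i : Fin p, d (Fin.castLE hp i) : ℕ) : ℂ) •
        (((γM : ↥(AddSubgroup.toIntSubmodule ((integralHodgeClassesIn Φ (2 * p) p).addSubgroupOf (integralForms Φ (2 * p))))) :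
          ↥(integralForms Φ (2 * p))) : E [⋀^Fin (2 * p)]→L[ℝ] ℂ) ∧
      wedgePow (ofRealForm η) q = ((q.factorial * ∏ i : Fin q, d (Fin.castLE hq i) : ℕ) : ℂ) • γq ∧
      (∀ x y : ↥(integralForms Φ (2 * p)),
        ((B x y : ℤ) : ℂ) = poincarePairing Φ e hn (x : E [⋀^Fin (2 * p)]→L[ℝ] ℂ) (γq.wedge (y : E [⋀^Fin (2 * p)]→L[ℝ] ℂ))) ∧ B.IsSymm ∧
      0 < δ' ∧
      ((∀ w ∈ integralHodgeClassesIn Φ (2 * (p + q)) (p + q), ∃ c : ℤ,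
          poincarePairing Φ e hn₂ (wedgePow (ofRealForm η) p) w = c ∧ (δ' : ℤ) ∣ c) ∧
        ∃ w ∈ integralHodgeClassesIn Φ (2 * (p + q)) (p + q), poincarePairing Φ e hn₂ (wedgePow (ofRealForm η) p) w = (δ' : ℂ)) ∧
      ∀ (Λ : Submodule ℤ ↥(AddSubgroup.toIntSubmodule ((integralHodgeClassesIn Φ (2 * p) p).addSubgroupOf (integralForms Φ (2 * p))))),
        (∀ x, x ∈ Λ ↔ ∃ a : ℤ, a • γM = x) →
        (Λ ⊔ (B.restrict (AddSubgroup.toIntSubmodule ((integralHodgeClassesIn Φ (2 * p) p).addSubgroupOf (integralForms Φ (2 * p))))).orthogonal Λ).toAddSubgroup.index *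
          δ' = (j + 2).choose p * p.factorial := by
  obtain ⟨γM, hγM⟩ := hd.exists_minimalClass_mem_toIntSubmodule hη hp
  obtain ⟨γq, hγqZ, hγq⟩ := hd.exists_mem_integralForms_wedgePow_eq_content_smul hq
  obtain ⟨B, hB⟩ := exists_bilinForm_eq_poincarePairing_wedge_of_degree Φ hγqZ e hn
  obtain ⟨δ', hδ'pos, hδ'⟩ := hd.exists_thetaDegree_generator hη hpq (show p + q + p = j + 2 by omega) e hn₂
  exact ⟨γM, γq, B, δ', hγM, hγq, hB, hd.isSymm_of_eq_poincarePairing_wedge_of_even hη (even_two_mul p) hkq hq hγq e hn hB, hδ'pos, hδ',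
    fun Λ hΛ ↦ (hd.index_top_splitting_mul_thetaDegree_generator_eq_of_type_one Φ hη h1 hp hq hpq hkq hγq e hn
      (show 2 * (p + q) + 2 * p = n by omega) hn₂ hB γM hγM Λ hΛ hδ').1⟩

/-- **PRINCIPALLY POLARISED ABELIAN SURFACES: `[NS(X) : ℤθ ⊕ θ^⊥] · min{(θ·D) > 0} = 2`** (`g = 2`, `p = 1`, `q = 0`: the Lefschetz form is the
intersection form, `γ₁ = θ`, and the integral Hodge curve classes are the divisor classes). Hence `NS(X) = ℤθ ⊕ θ^⊥` iff every `(θ·D)` is even, and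
`[NS(X) : ℤθ ⊕ θ^⊥] = 2` iff some divisor class has `(θ·D) = 1`.
[cite: Lange2023AbelianVarietiesComplex, §5.4.1 (5.22)–(5.23) (PDF p. 275); §2.5.3 Cor. 2.5.17 (d) (PDF p. 135); §6.3.2 Thm. 6.3.5 (p. 315)] [cite: Huybrechts2016K3, Ch. 14 §0.1–§0.2 (PDF p. 333)] -/
theorem IsPolarizationType.index_top_splitting_mul_thetaDegree_generator_eq_two_of_surface {d : Fin 2 → ℕ} (hd : IsPolarizationType Φ η d)
    (hη : IsRiemannForm Φ η) (h1 : ∀ i, d i = 1)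
    {γq : E [⋀^Fin (2 * 0)]→L[ℝ] ℂ} (hγq : wedgePow (ofRealForm η) 0 = ((Nat.factorial 0 * ∏ i : Fin 0, d (Fin.castLE (Nat.zero_le 2) i) : ℕ) : ℂ) • γq)
    (e : Fin n ≃ ι) (hn : 2 * 1 + (2 * 0 + 2 * 1) = n) (hn₁ : 2 * (1 + 0) + 2 * 1 = n) (hn₂ : 2 * 1 + 2 * (1 + 0) = n)
    {B : BilinForm ℤ ↥(integralForms Φ (2 * 1))}
    (hB : ∀ x y : ↥(integralForms Φ (2 * 1)),
      ((B x y : ℤ) : ℂ) = poincarePairing Φ e hn (x : E [⋀^Fin (2 * 1)]→L[ℝ] ℂ) (γq.wedge (y : E [⋀^Fin (2 * 1)]→L[ℝ] ℂ)))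
    (γM : ↥(AddSubgroup.toIntSubmodule ((integralHodgeClassesIn Φ (2 * 1) 1).addSubgroupOf (integralForms Φ (2 * 1)))))
    (hγM : wedgePow (ofRealForm η) 1 = ((Nat.factorial 1 * ∏ i : Fin 1, d (Fin.castLE (Nat.le_succ 1) i) : ℕ) : ℂ) •
      (((γM : ↥(AddSubgroup.toIntSubmodule ((integralHodgeClassesIn Φ (2 * 1) 1).addSubgroupOf (integralForms Φ (2 * 1))))) :
        ↥(integralForms Φ (2 * 1))) : E [⋀^Fin (2 * 1)]→L[ℝ] ℂ))
    (Λ : Submodule ℤ ↥(AddSubgroup.toIntSubmodule ((integralHodgeClassesIn Φ (2 * 1) 1).addSubgroupOf (integralForms Φ (2 * 1)))))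
    (hΛ : ∀ x, x ∈ Λ ↔ ∃ a : ℤ, a • γM = x) {δ' : ℕ}
    (hδ' : (∀ w ∈ integralHodgeClassesIn Φ (2 * (1 + 0)) (1 + 0), ∃ c : ℤ,
        poincarePairing Φ e hn₂ (wedgePow (ofRealForm η) 1) w = c ∧ (δ' : ℤ) ∣ c) ∧
      ∃ w ∈ integralHodgeClassesIn Φ (2 * (1 + 0)) (1 + 0), poincarePairing Φ e hn₂ (wedgePow (ofRealForm η) 1) w = (δ' : ℂ)) :
    (Λ ⊔ (B.restrict (AddSubgroup.toIntSubmodule ((integralHodgeClassesIn Φ (2 * 1) 1).addSubgroupOf (integralForms Φ (2 * 1))))).orthogonal Λ).toAddSubgroup.index *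
          δ' = 2 ∧
      ((Λ ⊔ (B.restrict (AddSubgroup.toIntSubmodule ((integralHodgeClassesIn Φ (2 * 1) 1).addSubgroupOf (integralForms Φ (2 * 1))))).orthogonal Λ).toAddSubgroup.index = 1 ↔
        δ' = 2) ∧
      ((Λ ⊔ (B.restrict (AddSubgroup.toIntSubmodule ((integralHodgeClassesIn Φ (2 * 1) 1).addSubgroupOf (integralForms Φ (2 * 1))))).orthogonal Λ).toAddSubgroup.index = 2 ↔
        δ' = 1) := by
  have h := (hd.index_top_splitting_mul_thetaDegree_generator_eq_of_type_one Φ hη h1 (Nat.le_succ 1) (Nat.zero_le 2) (Nat.le_succ 1) rfl hγq e hn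
    hn₁ hn₂ hB γM hγM Λ hΛ hδ').1
  have h2 : Nat.choose (0 + 2) 1 * Nat.factorial 1 = 2 := by decide
  rw [h2] at h
  exact ⟨h, eq_one_iff_and_eq_iff₁₀₅ h two_pos⟩

end Principal

/-! ## §2 Every type: `J_p(X)·δ̂_{g−p}(X̂, E_δ)·C_p·C_{g−p} = C_g·Ĉ_p` -/

section Dual

variable {ι : Type*} [Fintype ι] [LinearOrder ι] {E : Type uE} [NormedAddCommGroup E] [NormedSpace ℂ E]
  (Φ : (ι → ℝ) ≃L[ℝ] E) {j n p q : ℕ} {η : E [⋀^Fin 2]→L[ℝ] ℝ} {d : Fin (j + 2) → ℕ}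

/-- **`δ̂_{g−p}(X̂, E_δ) = Ĉ_p·n_p`**: the least positive `θ̂^{∧p}`-degree of a class in `Hdg^{g−p}(X̂, ℤ)` for the dual polarisation `θ̂ = E_δ = d₁d_g·E^*`
is the content `Ĉ_p = p!·δ̂₁⋯δ̂_p` of `θ̂^{∧p}` times the index `n_p = [B(γ_p, H^{2p}(X, ℤ)) : B(γ_p, Hdgᵖ(X, ℤ))]` of `X` (`2p + q = g`): `n_p` generates
`⟨γ_{g−p}, Hdgᵖ(X, ℤ)⟩` (g49-#7), which is `⟨γ̂_p, Hdg^{g−p}(X̂, ℤ)⟩` by the Fourier transform (g50-#2), and `θ̂^{∧p} = Ĉ_p·γ̂_p`.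
[cite: Lange2023AbelianVarietiesComplex, §6.2.4 Prop. 6.2.20, Prop. 6.2.21 (pp. 310–311); §6.3.2 Thm. 6.3.5 (p. 315); §2.5.1 Prop. 2.5.1 (p. 131); §5.4.1 (5.22)–(5.23) (PDF p. 275); §2.5.3 Thm. 2.5.16 (PDF p. 135)] [cite: Beauville1983FourierChow, §3 Prop. 5 (p. 248)] -/
theorem IsPolarizationType.dual_thetaDegree_generator_eq_content_mul_relIndex (hd : IsPolarizationType Φ η d) (hη : IsRiemannForm Φ η)
    (hp : p ≤ j + 2) (hq : q ≤ j + 2) (hpq : p + q ≤ j + 2) (hkq : 2 * p + q = j + 2)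
    {γq : E [⋀^Fin (2 * q)]→L[ℝ] ℂ} (hγq : wedgePow (ofRealForm η) q = ((q.factorial * ∏ i : Fin q, d (Fin.castLE hq i) : ℕ) : ℂ) • γq)
    (e : Fin n ≃ ι) (hn : 2 * p + (2 * q + 2 * p) = n) (hn₁ : 2 * (p + q) + 2 * p = n) (hn₂ : 2 * p + 2 * (p + q) = n)
    {B : BilinForm ℤ ↥(integralForms Φ (2 * p))}
    (hB : ∀ x y : ↥(integralForms Φ (2 * p)),
      ((B x y : ℤ) : ℂ) = poincarePairing Φ e hn (x : E [⋀^Fin (2 * p)]→L[ℝ] ℂ) (γq.wedge (y : E [⋀^Fin (2 * p)]→L[ℝ] ℂ)))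
    (γM : ↥(AddSubgroup.toIntSubmodule ((integralHodgeClassesIn Φ (2 * p) p).addSubgroupOf (integralForms Φ (2 * p)))))
    (hγM : wedgePow (ofRealForm η) p = ((p.factorial * ∏ i : Fin p, d (Fin.castLE hp i) : ℕ) : ℂ) •
      (((γM : ↥(AddSubgroup.toIntSubmodule ((integralHodgeClassesIn Φ (2 * p) p).addSubgroupOf (integralForms Φ (2 * p))))) :
        ↥(integralForms Φ (2 * p))) : E [⋀^Fin (2 * p)]→L[ℝ] ℂ)) {δ' : ℕ}
    (hδ' : (∀ w ∈ integralHodgeClassesIn (dualPeriod Φ) (2 * (p + q)) (p + q), ∃ c : ℤ,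
        poincarePairing (dualPeriod Φ) e hn₂
          (wedgePow (ofRealForm (((d 0 * d (Fin.last (j + 1)) : ℕ) : ℝ) • dualForm Φ hη.1 hη.nondegenerate)) p) w = c ∧ (δ' : ℤ) ∣ c) ∧
      ∃ w ∈ integralHodgeClassesIn (dualPeriod Φ) (2 * (p + q)) (p + q),
        poincarePairing (dualPeriod Φ) e hn₂
          (wedgePow (ofRealForm (((d 0 * d (Fin.last (j + 1)) : ℕ) : ℝ) • dualForm Φ hη.1 hη.nondegenerate)) p) w = (δ' : ℂ)) :
    δ' = (p.factorial * ∏ i : Fin p, d 0 * d (Fin.last (j + 1)) / d (Fin.rev (Fin.castLE hp i))) *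
      (LinearMap.range (B.restrict (AddSubgroup.toIntSubmodule ((integralHodgeClassesIn Φ (2 * p) p).addSubgroupOf (integralForms Φ (2 * p)))) γM)).toAddSubgroup.relIndex
        (LinearMap.range (B (γM : ↥(integralForms Φ (2 * p))))).toAddSubgroup := by
  obtain ⟨γpq, -, hγpq⟩ := hd.exists_mem_integralForms_wedgePow_eq_content_smul hpq
  -- `n_p` generates `⟨γ_{p+q}, Hdgᵖ(X, ℤ)⟩`
  have hgen := hd.relIndex_range_dvd_poincarePairing_minimalClass_and_exists_eq hη hp hq hpq hγq hγpq e hn hn₁ hB γM hγM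
  have hgen' : (∀ z ∈ integralHodgeClassesIn Φ (2 * p) p, ∃ c : ℤ, poincarePairing Φ e hn₁ γpq z = c ∧
        (((LinearMap.range (B.restrict (AddSubgroup.toIntSubmodule ((integralHodgeClassesIn Φ (2 * p) p).addSubgroupOf (integralForms Φ (2 * p)))) γM)).toAddSubgroup.relIndex
          (LinearMap.range (B (γM : ↥(integralForms Φ (2 * p))))).toAddSubgroup : ℕ) : ℤ) ∣ c) ∧
      ∃ z ∈ integralHodgeClassesIn Φ (2 * p) p, poincarePairing Φ e hn₁ γpq z =
        (((LinearMap.range (B.restrict (AddSubgroup.toIntSubmodule ((integralHodgeClassesIn Φ (2 * p) p).addSubgroupOf (integralForms Φ (2 * p)))) γM)).toAddSubgroup.relIndex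
          (LinearMap.range (B (γM : ↥(integralForms Φ (2 * p))))).toAddSubgroup : ℕ) : ℂ) := by
    refine ⟨fun z hz ↦ hgen.1 ⟨⟨z, integralHodgeClassesIn_le_integralForms Φ (2 * p) p hz⟩, AddSubgroup.mem_addSubgroupOf.2 hz⟩, ?_⟩
    obtain ⟨y, hy⟩ := hgen.2
    exact ⟨_, AddSubgroup.mem_addSubgroupOf.1 y.2, hy⟩
  -- transport to `X̂`: `n_p` generates `⟨γ̂_p, Hdg^{p+q}(X̂, ℤ)⟩`
  have hd' := hd.dual Φ hη
  obtain ⟨γ', -, hγ'⟩ := hd'.exists_mem_integralForms_wedgePow_eq_content_smul hp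
  have hdual := hd.minimalClass_valueGenerator_dual Φ hη hpq hp (show p + q + p = j + 2 by omega) e hn₁ hn₂ hγpq hγ' hgen'
  -- the `θ̂^{∧p}`-degrees are `Ĉ_p` times the `γ̂_p`-values, so `Ĉ_p·n_p` is a generator; generators are unique
  refine thetaDegree_generator_unique e hn₂ hδ' ⟨fun w hw ↦ ?_, ?_⟩
  · obtain ⟨c, hc, hdvd⟩ := hdual.1 w hw
    refine ⟨((p.factorial * ∏ i : Fin p, d 0 * d (Fin.last (j + 1)) / d (Fin.rev (Fin.castLE hp i)) : ℕ) : ℤ) * c, ?_, ?_⟩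
    · rw [hγ', map_smul, LinearMap.smul_apply, smul_eq_mul, hc, Int.cast_mul, Int.cast_natCast]
    · rw [Nat.cast_mul]
      exact mul_dvd_mul_left _ hdvd
  · obtain ⟨w, hw, hwε⟩ := hdual.2
    refine ⟨w, hw, ?_⟩
    rw [hγ', map_smul, LinearMap.smul_apply, smul_eq_mul, hwε]
    push_cast
    ring

/-- **EVERY TYPE: `[Hdgᵖ(X, ℤ) : ℤγ_p ⊕ γ_p^⊥] · δ̂_{g−p}(X̂, E_δ) · C_p · C_{g−p} = C_g · Ĉ_p`** (`2p + q = g`, `C_m = m!·d₁⋯d_m`, `Ĉ_p = p!·δ̂₁⋯δ̂_p`): the index of the top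
splitting of the integral Hodge lattice of `X` against the least `θ̂^{∧p}`-degree of a class in `Hdg^{g−p}(X̂, ℤ)` on the dual polarised torus (g48-#6's sharp
formula `J_p·n_p·C_p·C_{g−p} = C_g` with `δ̂_{g−p}(X̂, E_δ) = Ĉ_p·n_p`). Principal: `J_p·δ_{g−p}(X̂) = g!/(g−p)!` (and `X̂ ≅ X`, §1).
[cite: Lange2023AbelianVarietiesComplex, §5.4.1 Thm. 5.4.2 and (5.22)–(5.23) (PDF p. 275); §2.5.3 Thm. 2.5.16, Cor. 2.5.17 (d) (PDF p. 135); §6.2.4 Prop. 6.2.20, Prop. 6.2.21 (pp. 310–311); §6.3.2 Thm. 6.3.5 (p. 315); §2.5.1 Prop. 2.5.1 (p. 131)] [cite: Beauville1983FourierChow, §3 Prop. 5 (p. 248)] [cite: Huybrechts2016K3, Ch. 14 §0.1–§0.2] -/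
theorem IsPolarizationType.index_top_splitting_mul_dual_thetaDegree_generator_mul_content_eq (hd : IsPolarizationType Φ η d)
    (hη : IsRiemannForm Φ η) (hp : p ≤ j + 2) (hq : q ≤ j + 2) (hpq : p + q ≤ j + 2) (hkq : 2 * p + q = j + 2)
    {γq : E [⋀^Fin (2 * q)]→L[ℝ] ℂ} (hγq : wedgePow (ofRealForm η) q = ((q.factorial * ∏ i : Fin q, d (Fin.castLE hq i) : ℕ) : ℂ) • γq)
    (e : Fin n ≃ ι) (hn : 2 * p + (2 * q + 2 * p) = n) (hn₁ : 2 * (p + q) + 2 * p = n) (hn₂ : 2 * p + 2 * (p + q) = n)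
    {B : BilinForm ℤ ↥(integralForms Φ (2 * p))}
    (hB : ∀ x y : ↥(integralForms Φ (2 * p)),
      ((B x y : ℤ) : ℂ) = poincarePairing Φ e hn (x : E [⋀^Fin (2 * p)]→L[ℝ] ℂ) (γq.wedge (y : E [⋀^Fin (2 * p)]→L[ℝ] ℂ)))
    (γM : ↥(AddSubgroup.toIntSubmodule ((integralHodgeClassesIn Φ (2 * p) p).addSubgroupOf (integralForms Φ (2 * p)))))
    (hγM : wedgePow (ofRealForm η) p = ((p.factorial * ∏ i : Fin p, d (Fin.castLE hp i) : ℕ) : ℂ) •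
      (((γM : ↥(AddSubgroup.toIntSubmodule ((integralHodgeClassesIn Φ (2 * p) p).addSubgroupOf (integralForms Φ (2 * p))))) :
        ↥(integralForms Φ (2 * p))) : E [⋀^Fin (2 * p)]→L[ℝ] ℂ))
    (Λ : Submodule ℤ ↥(AddSubgroup.toIntSubmodule ((integralHodgeClassesIn Φ (2 * p) p).addSubgroupOf (integralForms Φ (2 * p)))))
    (hΛ : ∀ x, x ∈ Λ ↔ ∃ a : ℤ, a • γM = x) {δ' : ℕ}
    (hδ' : (∀ w ∈ integralHodgeClassesIn (dualPeriod Φ) (2 * (p + q)) (p + q), ∃ c : ℤ,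
        poincarePairing (dualPeriod Φ) e hn₂
          (wedgePow (ofRealForm (((d 0 * d (Fin.last (j + 1)) : ℕ) : ℝ) • dualForm Φ hη.1 hη.nondegenerate)) p) w = c ∧ (δ' : ℤ) ∣ c) ∧
      ∃ w ∈ integralHodgeClassesIn (dualPeriod Φ) (2 * (p + q)) (p + q),
        poincarePairing (dualPeriod Φ) e hn₂
          (wedgePow (ofRealForm (((d 0 * d (Fin.last (j + 1)) : ℕ) : ℝ) • dualForm Φ hη.1 hη.nondegenerate)) p) w = (δ' : ℂ)) :
    (Λ ⊔ (B.restrict (AddSubgroup.toIntSubmodule ((integralHodgeClassesIn Φ (2 * p) p).addSubgroupOf (integralForms Φ (2 * p))))).orthogonal Λ).toAddSubgroup.index *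
          δ' * ((p.factorial * ∏ i : Fin p, d (Fin.castLE hp i)) * ((p + q).factorial * ∏ i : Fin (p + q), d (Fin.castLE hpq i))) =
      ((j + 2).factorial * ∏ i, d i) * (p.factorial * ∏ i : Fin p, d 0 * d (Fin.last (j + 1)) / d (Fin.rev (Fin.castLE hp i))) := by
  have hsharp := (hd.index_top_splitting_mul_relIndex_range_mul_content_eq hη hp hq hpq hkq hγq e hn hB γM hγM Λ hΛ).1
  rw [hd.dual_thetaDegree_generator_eq_content_mul_relIndex Φ hη hp hq hpq hkq hγq e hn hn₁ hn₂ hB γM hγM hδ', ← hsharp]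
  ring

end Dual

end Literature.Geometry.Kaehler.ComplexTorus

end
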